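import Summits.QuantumFields.YangMills.Theorems.ForcedResponseSkewnessRunningCouplingCeilingSmearScalewise
import HarnessLib

/-!
# Route `ForcedResponseSkewness`, crux `RunningCouplingCeiling` ⟨stmt-QuantumFields-24275⟩ — `FloorToAxis` (RP-soft stub of the
# alternative skeleton line «moebius-crossover-export», ym-idea-3 g26, critic PASS by hash 2026-08-30T00:10:59Z) PROVED in its letter

Helper file (`--supports stmt-QuantumFields-24275`; free-hands seat `ym-line-frs-p2` g20).  Definition-free, 0 sorry, standard axioms.
No item is closed; no summit, no crux and no mass gap is proved by this file.

`floorToAxis` is the skeleton's `def FloorToAxis : Prop` (HOME `ym-idea-3/g26/line-moebius-crossover-export.lean` l.147, namespace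
`…Cruxes.RunningCouplingCeiling.MoebiusCrossover`) with the skeleton-local `axisGs r β L t = max (axisG …) (axisG' …)` UNFOLDED to
`max ((2t)⁸·lCC(Q^θ,Q,2t)) ((2t)⁸·lCC(Q,Q^θ,2t))` (so the stub closes by `exact floorToAxis` up to `δ`-unfolding): a clause-(i) floor
`ε ≤ Q2_{β,L,s}(θv₀, v₀)` for a compactly supported positive-time `v₀` forces, at every `β ≥ 0`, every small spacing `s ≤ s₁(v₀)` and every
large torus `s·L ≥ Λ₁(v₀)`, SOME lattice height `t` with `ρ₁ ≤ s t ≤ ρ₂` and symmetrised on-axis coupling `≥ ε'' = ε m⁸/(2(‖v₀‖₁+1)²)`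
(`[m, M]` the time window of `tsupport v₀`, `ρ₁ = m/2`, `ρ₂ = M + m/2`).  Proof = ✓`exists_axis_floor_of_Q2_floor` (contrapositive of the
scalewise smearing bound ✓`Q2_le_of_axis_window`, itself resting on the reflection-positivity axis domination ✓`sq_torusCov_le_lcc_mul_lcc`)
+ lattice Riemann sums ✓`exists_latticeSum_abs_le` + ✓`exists_time_window_of_hasCompactSupport`.

[cite: OsterwalderSeiler1978, §2]; [cite: OS1973, §2].  HONEST LABEL: a soft transfer lemma; `MoebiusRow` (XL) / `CrossoverDecay` (L–XL),
⟨24275⟩, ⟨23763⟩, ⟨26871⟩ OPEN; the Yang–Mills mass gap is NOT proved; no summit is proved by a line.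
-/

set_option autoImplicit false

noncomputable section

open Set Metric MeasureTheory Filter Topology
open scoped SchwartzMap
open Literature.MathematicalPhysics.QuantumFieldTheory Literature.MathematicalPhysics.QuantumLattice
open Literature.Probability.LatticeModels
open Summit.QuantumFields.YangMills.Cruxes.OSLegsFromFemtoAndGap.DlrCollarTransfer
open Summit.QuantumFields.YangMills.Cruxes.RunningCouplingCeiling.Pointwise (exists_latticeSum_abs_le)
open Summit.QuantumFields.YangMills.Cruxes.NT.CeilingPrice (integral_abs_thetaTest)
open Summit.QuantumFields.YangMills.Cruxes.NT.Reference (tsupport_thetaTest_subset_closedBall_zero)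
open Summit.QuantumFields.YangMills.Theorems.ForcedResponseSkewnessRunningCouplingCeilingSmearScalewise
  (exists_axis_floor_of_Q2_floor exists_time_window_of_hasCompactSupport)

namespace Summit.QuantumFields.YangMills.Theorems.ForcedResponseSkewnessRunningCouplingCeilingFloorToAxis

/-- ★ **`FloorToAxis`** (the RP-soft stub `stub_floorToAxis` of line «moebius-crossover-export» on ⟨stmt-QuantumFields-24275⟩, in its
letter with `axisGs` unfolded): a smeared clause-(i) floor forces the symmetrised on-axis coupling above `ε'' > 0` at some height
`t` with `ρ₁ ≤ s t ≤ ρ₂`. [cite: OsterwalderSeiler1978, §2] [cite: OS1973, §2] -/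
theorem floorToAxis : ∀ (G : Type) [Group G] [TopologicalSpace G] [IsTopologicalGroup G] [CompactSpace G],
    IsCompactSimpleLieGroup G →
    letI : MeasurableSpace G := borel G
    haveI : BorelSpace G := ⟨rfl⟩
    ∀ (r : LatticeRep G) (v₀ : 𝓢(EuclideanSpace ℝ (Fin 4), ℝ)) (ε : ℝ),
      HasCompactSupport (v₀ : EuclideanSpace ℝ (Fin 4) → ℝ) →
      tsupport (v₀ : EuclideanSpace ℝ (Fin 4) → ℝ) ⊆ {y : EuclideanSpace ℝ (Fin 4) | 0 < y 0} → 0 < ε →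
      ∃ ρ₁ ρ₂ ε'' s₁ Λ₁ : ℝ, 0 < ρ₁ ∧ ρ₁ ≤ ρ₂ ∧ 0 < ε'' ∧ 0 < s₁ ∧
        ∀ β : ℝ, 0 ≤ β → ∀ (L : ℕ) (s : ℝ), 0 < s → s ≤ s₁ → Λ₁ ≤ s * L →
          ε ≤ Q2 G r β L s (thetaTest 4 v₀) v₀ →
            ∃ t : ℕ, ρ₁ ≤ s * t ∧ s * t ≤ ρ₂ ∧
              ε'' ≤ max (((2 * t : ℕ) : ℝ) ^ 8 *
                    latticeConnectedCorr r.ρ β (2 * L + 1) r.curvature.timeReflect.F r.curvature.F (2 * t))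
                  (((2 * t : ℕ) : ℝ) ^ 8 *
                    latticeConnectedCorr r.ρ β (2 * L + 1) r.curvature.F r.curvature.timeReflect.F (2 * t)) := by
  intro G _ _ _ _ _hG
  letI : MeasurableSpace G := borel G
  haveI : BorelSpace G := ⟨rfl⟩
  intro r v₀ ε hc hpos hε
  obtain ⟨m, M, hm, hmM, hwin, hKM⟩ := exists_time_window_of_hasCompactSupport v₀ hc hpos
  have hθvM : tsupport (thetaTest 4 v₀ : EuclideanSpace ℝ (Fin 4) → ℝ) ⊆ closedBall 0 M :=
    tsupport_thetaTest_subset_closedBall_zero hKM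
  obtain ⟨s₁, hs₁, h₁⟩ := exists_latticeSum_abs_le v₀ hKM
  obtain ⟨s₂, hs₂, h₂⟩ := exists_latticeSum_abs_le (thetaTest 4 v₀) hθvM
  set I : ℝ := (∫ y, |v₀ y|) + 1 with hI_def
  have hI0 : 0 < I := by
    have : 0 ≤ ∫ y, |v₀ y| := integral_nonneg fun _ => abs_nonneg _
    rw [hI_def]; linarith
  -- the axis floor `η = ε m⁸ / (2 I²)` and the thresholds
  set η : ℝ := ε * m ^ 8 / (2 * I ^ 2) with hη_def
  have hη : 0 < η := by rw [hη_def]; positivity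
  set s₀ : ℝ := min (min s₁ s₂) (min (m / 2) 1) with hs₀_def
  have hs₀ : 0 < s₀ := lt_min (lt_min hs₁ hs₂) (lt_min (by positivity) one_pos)
  refine ⟨m / 2, M + m / 2, η, s₀, M + 2, by positivity, by linarith, hη, hs₀, ?_⟩
  intro β hβ L s hs hss₀ hL hfl
  have hss₁ : s ≤ s₁ := hss₀.trans ((min_le_left _ _).trans (min_le_left _ _))
  have hss₂ : s ≤ s₂ := hss₀.trans ((min_le_left _ _).trans (min_le_right _ _))
  have hsm2 : s ≤ m / 2 := hss₀.trans ((min_le_right _ _).trans (min_le_left _ _))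
  have hs1 : s ≤ 1 := hss₀.trans ((min_le_right _ _).trans (min_le_right _ _))
  have hsm : 3 * s ≤ 2 * m := by linarith
  have hMR : M ≤ s * L := by linarith
  have hL' : M / s + 2 ≤ (L : ℝ) := by
    rw [div_add' _ _ _ hs.ne', div_le_iff₀ hs]
    nlinarith
  -- Riemann factors
  have hX : (∑ x ∈ box 4 L, |thetaTest 4 v₀ (s • siteToE x)|) * (∑ y ∈ box 4 L, |v₀ (s • siteToE y)|) ≤ I ^ 2 / s ^ 8 := by
    have e1 : s ^ 4 * ∑ y ∈ box 4 L, |v₀ (s • siteToE y)| ≤ I := h₁ s hs hss₁ L hMR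
    have e2 : s ^ 4 * ∑ x ∈ box 4 L, |thetaTest 4 v₀ (s • siteToE x)| ≤ I := by
      have := h₂ s hs hss₂ L hMR
      rw [integral_abs_thetaTest] at this
      exact this
    have hY0 : 0 ≤ ∑ x ∈ box 4 L, |thetaTest 4 v₀ (s • siteToE x)| := Finset.sum_nonneg fun _ _ => abs_nonneg _
    rw [le_div_iff₀ (by positivity)]
    calc (∑ x ∈ box 4 L, |thetaTest 4 v₀ (s • siteToE x)|) * (∑ y ∈ box 4 L, |v₀ (s • siteToE y)|) * s ^ 8
        = (s ^ 4 * ∑ x ∈ box 4 L, |thetaTest 4 v₀ (s • siteToE x)|) *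
            (s ^ 4 * ∑ y ∈ box 4 L, |v₀ (s • siteToE y)|) := by ring
      _ ≤ I * I := mul_le_mul e2 e1 (by positivity) hI0.le
      _ = I ^ 2 := by ring
  have hfv : ∀ w : EuclideanSpace ℝ (Fin 4), thetaTest 4 v₀ w ≠ 0 → -M ≤ w 0 ∧ w 0 ≤ -m := by
    intro w hw
    rw [thetaTest_apply] at hw
    obtain ⟨h1, h2⟩ := hwin _ hw
    have h0 : timeReflection 4 w 0 = -w 0 := by simp
    rw [h0] at h1 h2
    constructor <;> linarith
  have hBε : (s / m) ^ 8 * η * (I ^ 2 / s ^ 8) < ε := by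
    have e : (s / m) ^ 8 * η * (I ^ 2 / s ^ 8) = ε / 2 := by
      rw [hη_def, div_pow]
      field_simp
    rw [e]
    linarith
  obtain ⟨t, ht1, ht2, hGt⟩ :=
    exists_axis_floor_of_Q2_floor r hβ L hs hm (thetaTest 4 v₀) v₀ hfv hwin hsm hL' hη.le hX hfl hBε
  refine ⟨t, ?_, ?_, ?_⟩
  · -- `s t ≥ m − s ≥ m/2`
    have : m - s ≤ s * t := by
      have h := mul_le_mul_of_nonneg_left ht1 hs.le
      rw [mul_sub, mul_div_cancel₀ _ hs.ne', mul_one] at h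
      exact h
    linarith
  · -- `s t ≤ M + s ≤ M + m/2`
    have : s * t ≤ M + s := by
      have h := mul_le_mul_of_nonneg_left ht2 hs.le
      rw [mul_add, mul_div_cancel₀ _ hs.ne', mul_one] at h
      exact h
    linarith
  · rcases hGt with h | h
    · exact le_trans h.le (le_max_left _ _)
    · exact le_trans h.le (le_max_right _ _)

end Summit.QuantumFields.YangMills.Theorems.ForcedResponseSkewnessRunningCouplingCeilingFloorToAxis

end
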